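import Summits.SmoothPoincare4.SmoothPoincare4.Theses.VerlindeRLinks
import Literature.Topology.FourManifolds.OneHandleBoundaryStepProofs

/-!
# Line `kirby-lemma21`, Stub 3 (`stub_oneHandlebody_boundary`): `∂(♮ⁿ S¹ × B³) = #ⁿ(S² × S¹)`
(crux `VerlindeRLinks.VrlComponentsHBallSlice`, item stmt-SmoothPoincare4-15874)

This file states and proves the registered stub `stub_oneHandlebody_boundary` (signature verbatim
from the skeleton `Cruxes/VrlComponentsHBallSlice/Lines/kirby_lemma21.lean`): for every `n` some
compact connected orientable smooth `4`-manifold with boundary `V` with a handle decomposition into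
one `0`-handle and `n` `1`-handles (`HasHandleDecomposition 3 V (handleCount 1 n)`) has a boundary
datum whose carrier is `#ⁿ(S² × S¹)` in the recursive sense `IsSphereTwoProdCircleSum n`.  It is the
tree theorem `exists_oneHandlebody_four_boundary_isSphereTwoProdCircleSum_holds`
(`OneHandleBoundaryStepProofs.lean`): UNIQ₄ induction along one-handle attachments
(`OneHandlebodyBoundarySum.lean`), the boundary of a one-handle attachment as the `0`-surgery of the
lower boundary along a framed `S⁰` (`OneHandleAttachmentBoundarySurgery.lean`, Milnor 1965,
Thm. 3.13), and the `S⁰`-surgery lemma "`0`-surgery along an orientably framed `S⁰` in a connected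
`3`-manifold `Z` is `Z # (S² × S¹)`" (`ZeroSphereSurgeryConnectedSum.lean`, Kosinski 1993, VI §9).

References: R. C. Kirby, *The Topology of 4-Manifolds* (1989), Ch. I §2, p. 8; A. A. Kosinski,
*Differential Manifolds* (1993), VI (3.1), (6.6), §9, (11.4); J. Milnor, *Lectures on the
h-cobordism theorem* (1965), Thm. 3.13.
-/

noncomputable section

-- the prescribed namespace `Summit.<P>.<Sub>.…` duplicates `SmoothPoincare4` (P = Sub)
set_option linter.dupNamespace false

open scoped Manifold ContDiff Topology
open Set Function Literature.Topology.FourManifolds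

namespace Summit.SmoothPoincare4.SmoothPoincare4.Theorems.VrlComponentsHBallSlice.KirbyLemma21

/-- **Stub 3 of line `kirby-lemma21` — `∂(♮ⁿ S¹ × B³) ≅ #ⁿ(S² × S¹)`** (`stub_oneHandlebody_boundary`,
registered signature verbatim).  For every `n` there are a compact connected orientable smooth
`4`-manifold with boundary `V : Type` with a handle decomposition into one `0`-handle and `n`
`1`-handles and a boundary datum `bV` with `IsSphereTwoProdCircleSum n bV.carrier`: the tree theorem
`exists_oneHandlebody_four_boundary_isSphereTwoProdCircleSum_holds` (Kirby 1989, Ch. I §2, p. 8;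
Kosinski 1993, VI (11.4), §9). [cite: Kirby1989, Ch. I §2, p. 8] [cite: Kosinski1993, VI (11.4) and §9] -/
theorem stub_oneHandlebody_boundary :
    ∀ n : ℕ, ∃ (V : Type) (_ : TopologicalSpace V) (_ : T2Space V) (_ : SecondCountableTopology V)
      (_ : ChartedSpace (EuclideanHalfSpace 4) V) (_ : IsManifold (𝓡∂ 4) ((⊤ : ℕ∞) : WithTop ℕ∞) V)
      (_ : CompactSpace V) (_ : ConnectedSpace V) (bV : BoundaryData (𝓡∂ 4) V (𝓡 3)),
      HasHandleDecomposition 3 V (handleCount 1 n) ∧ IsOrientable (𝓡∂ 4) V ∧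
        IsSphereTwoProdCircleSum n bV.carrier :=
  fun n => exists_oneHandlebody_four_boundary_isSphereTwoProdCircleSum_holds n

end Summit.SmoothPoincare4.SmoothPoincare4.Theorems.VrlComponentsHBallSlice.KirbyLemma21
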